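import Summits.HodgeConjecture.CorCM.GaloisIndexTwoTimesTwo
import HarnessLib

/-!
# `Γ₀ × H` is BAD for EVERY non-trivial abelian `H` once `A₀` is not a cyclic `2`-group — the index-two real-factor theorem

COR-CM (cell `pub-hodgecm2`), binder seat b04 (gen 30), count-neutral own lane «Galois-CM-type classification» (which Galois CM
fields `(G, c)` have ALL primitive CM types nondegenerate = GOOD, vs. a primitive degenerate type = BAD).  KERNEL ONLY: theorems;
no definition, no named fact, no `sorry`.  `HC_CM` is neither used nor claimed.

SETTING.  `G₀ = i(A) ⊔ i(A)x` with `A = A₀ × C` abelian of index two, `x` acting as `θ₀ × id` (the factor `C` is CENTRAL in `G₀`),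
`x² = i(q)` ARBITRARY (easy or hard side), complex conjugation `c = (c₀, 1)`, `c₀ ∈ A₀`.  This is `Γ₀ × H` for `H = C` abelian and
`Γ₀ = i(A₀) ⊔ i(A₀)x₀`, but also non-split variants.  Gen 24's REAL-FACTOR theorem (`CorCM/GaloisRealFactorDegenerate`) needs
`H ∉ {1, C₂, C₂², C₂³, C₄, C_p, S₃}`; this generation's `CorCM/GaloisIndexTwoTimesTwo` did `C = C₂`.  HERE: **every `C ≠ 1`**.

THEOREM (**`exists_simple_degenerate_of_index_two_real_factor`**).  If `|A₀| > 4`, some `u ∈ A₀`, `u ≠ 1`, has `c₀ ∉ ⟨u⟩` (i.e. `A₀`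
is not a cyclic `2`-group), `C ≠ 1`, and `4·ord(u) < |A₀|·|C|` (automatic for `|C| ≥ 3` or `ord u` small), then `K` carries a SIMPLE
DEGENERATE abelian variety of dimension `|G₀|/2` with CM by `K` (rational `(p,p)` class outside the divisor ring on some power).
PROOF = two periodic sheets (`CorCM/GaloisTwoPeriodicSheets`): `S₀ = S̄₀ × C` with `S̄₀` an APERIODIC half of `(A₀, c₀)`
(`exists_aperiodic_half`, `|A₀| > 4`), periodic under `u₀ = (1, γ₀)`, `γ₀ ∈ C ∖ 1`; `S₁ =` pull-back of an APERIODIC half `H̄` of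
`Q = (A₀/⟨u⟩) × C` for `(c̄₀, 1)` (`|Q| > 4`), periodic under `u₁ = (u, 1)`; odd character `χ = χ₀ ⊗ ψ` with `χ₀(u) ≠ 1`
(`exists_odd_character_ne_one`) and `ψ(γ₀) ≠ 1` (`exists_character_ne_one`).  Joint primitivity: the period lattices are `1 × C`
and `⟨u⟩ × 1`, meeting trivially; and `a·θ(S₀)` is `(1 × C)`-periodic while `S₁` is not.

CONSEQUENCES.  On the HARD side this is new for the exceptional factors `C_p`, `C₄`: **`Dic_m × C_p`, `Dic_m × C₄` (m not a power
of 2), `(C_ℓ ⋊ C₈) × C_p`, `(C_ℓ ⋊ C_{2^k}) × C_n`, … are BAD**; combined with gen 24 and the `× C₂ ∕ × C₂²` theorems: for `Γ₀`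
with an abelian index-two subgroup `A₀ ∋ c` that is not a cyclic `2`-group (and `|A₀| > 4`), **`Γ₀ × H` is BAD for every
non-trivial abelian `H`** (the `|Q|` proviso only bites for `H = C₂` with `A₀ = C_{2ℓ}`, where `CorCM/GaloisIndexTwoTimesTwo`
applies instead).  The theorem is silent exactly where GOOD products live: `Q₈ × C_p`, `C_p ⋊ C₈` (there `A₀ = C₄` resp. the
`θ`-fixed factor contains `c`), `Q_{2^k} × C₂`, `D₄ × C₂`, `C₈ × C_p` (`A₀` cyclic `2`-group).

## References

* [Kubota1965] T. Kubota, *On the field extension by complex multiplication*, Trans. AMS 118 (1965), §2, §4 Lemma 2.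
* [Shimura1998] G. Shimura, *Abelian Varieties with Complex Multiplication and Modular Functions*, §6.2 Thm. 3, §8.2 Prop. 26.
* [Gordon1999HodgeAVSurvey] B. B. Gordon, *A survey of the Hodge conjecture for abelian varieties*, Thm. 6.4, §9.3.
-/

noncomputable section

open CategoryTheory CategoryTheory.Limits NumberField
open scoped BigOperators

namespace Summit.HodgeConjecture.CorCM.SplitInvolution

open Literature.NumberTheory.ComplexMultiplication
open Literature.AlgebraicGeometry.Motives (AbelianVariety CMType)
open Literature.AlgebraicGeometry.HodgeTheory
open Literature.AlgebraicGeometry.ComplexMultiplication (IsCMTypeRealisation)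
open Literature.AlgebraicGeometry.Pohlmann1968
open Literature.Barriers.HodgeConjecture (divisorClassesSpan)
open Summit.HodgeConjecture.CorCM.GaloisRank (model_complexConj_mul_self model_complexConj_comm)

section Character

variable {C : Type*} [CommGroup C] [Fintype C]

/-- Characters separate points: `γ ≠ 1` ⟹ some `ψ` with `ψ(γ) ≠ 1` (`Σ_ψ ψ(γ) = 0`). [folklore] -/
theorem exists_character_ne_one {γ : C} (hγ : γ ≠ 1) : ∃ ψ : AddChar (Additive C) ℂ, ψ (Additive.ofMul γ) ≠ 1 := by
  classical
  have hγ0 : Additive.ofMul γ ≠ 0 := fun h => hγ (by simpa using congrArg Additive.toMul h)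
  have hsum : ∑ ψ : AddChar (Additive C) ℂ, ψ (Additive.ofMul γ) = 0 := AddChar.sum_apply_eq_zero_iff_ne_zero.2 hγ0
  by_contra hall
  push Not at hall
  simp only [hall, Finset.sum_const, Finset.card_univ, nsmul_eq_mul, mul_one] at hsum
  exact Nat.cast_ne_zero.2 Fintype.card_ne_zero hsum

end Character

section Field

variable {G₀ : Type*} [Group G₀] [Fintype G₀] [DecidableEq G₀]
variable {A₀ : Type*} [CommGroup A₀] [Fintype A₀] [DecidableEq A₀]
variable {C : Type*} [CommGroup C] [Fintype C] [DecidableEq C]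
variable {K : Type} [Field K] [NumberField K] [IsCMField K] [IsGalois ℚ K]

/-- **THE INDEX-TWO REAL-FACTOR THEOREM.**  `K` Galois CM, `e : Gal(K/ℚ) ≃* G₀`; `i : A₀ × C ↪ G₀` abelian of index two
(`G₀ = i(A) ⊔ i(A)x`), `x i(a, γ) = i(θ₀ a, γ) x` (`C` central), `x² = i(q)` for ANY `q`; complex conjugation `e(c̄) = i(c₀, 1)`.  If
`|A₀| > 4`, `u ∈ A₀ ∖ 1` with `c₀ ∉ ⟨u⟩`, `γ₀ ∈ C ∖ 1`, and `4·ord(u) < |A₀|·|C|`, THEN `K` has a PRIMITIVE DEGENERATE CM type,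
realised by a SIMPLE abelian variety of dimension `|G₀|/2` with CM by `K` carrying a rational `(p,p)` class outside the divisor ring
on some power. [cite: Kubota1965, §2 and §4 Lemma 2] [cite: Shimura1998, §6.2 Thm. 3 and §8.2 Prop. 26]
[cite: Gordon1999HodgeAVSurvey, Thm. 6.4 and §9.3] -/
theorem exists_simple_degenerate_of_index_two_real_factor (e : (K ≃ₐ[ℚ] K) ≃* G₀) (i : A₀ × C →* G₀)
    (hi : Function.Injective i) (x : G₀) (hx : ∀ w, i w ≠ x) (hcov : ∀ g : G₀, (∃ w, g = i w) ∨ (∃ w, g = i w * x))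
    (θ₀ : A₀ ≃* A₀) (hθ : ∀ (a : A₀) (γ : C), x * i (a, γ) = i (θ₀ a, γ) * x) (q : A₀ × C) (hq : x * x = i q) (c₀ : A₀)
    (hc : e ((IsCMField.complexConj K).restrictScalars ℚ) = i (c₀, 1)) (hcard : 4 < Fintype.card A₀)
    (u : A₀) (hu : u ≠ 1) (hcu : c₀ ∉ Subgroup.zpowers u) (γ₀ : C) (hγ₀ : γ₀ ≠ 1)
    (hQ : 4 * orderOf u < Fintype.card A₀ * Fintype.card C) :
    ∃ (Φ : CMType K) (φ₀ : K →+* ℂ) (X : AbelianVariety ℂ) (ι : 𝓞 K →+* End X)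
      (ϑ : K →+* Module.End ℂ (complexBetti X.X 1)),
      IsPrimitive (ℂ ≃+* ℂ) Φ.1 φ₀ ∧ ¬ IsNondegenerate Φ ∧ IsCMTypeRealisation Φ X ι ϑ ∧ X.IsSimple ∧
      X.dim = Fintype.card G₀ / 2 ∧
      ∃ n p : ℕ, ∃ y : complexBetti (⨁ fun _ : Fin n => X).X (2 * p), IsRationalClass y ∧
        IsOfHodgeType (⨁ fun _ : Fin n => X).dim (⨁ fun _ : Fin n => X).X (2 * p) p p y ∧
        y ∉ divisorClassesSpan (⨁ fun _ : Fin n => X).X (⨁ fun _ : Fin n => X).dim p := by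
  classical
  set cA : A₀ × C := (c₀, 1) with hcA_def
  -- `c₀² = 1`, `c₀ ≠ 1`, `θ₀ c₀ = c₀`
  have hccA : cA * cA = 1 := hi (by rw [map_mul, map_one]; exact model_complexConj_mul_self e hc)
  have hcc : c₀ * c₀ = 1 := by simpa [hcA_def] using congrArg Prod.fst hccA
  have hc1 : c₀ ≠ 1 := by rintro rfl; exact hcu (one_mem _)
  let θ : A₀ × C ≃* A₀ × C := MulEquiv.prodCongr θ₀ (MulEquiv.refl _)
  have hθ_apply : ∀ w, θ w = (θ₀ w.1, w.2) := fun w => rfl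
  have hθ' : ∀ w, x * i w = i (θ w) * x := fun ⟨a, γ⟩ => hθ a γ
  have hθc : θ₀ c₀ = c₀ := by
    have h1 : i cA * x = i (θ cA) * x := by rw [← hθ', model_complexConj_comm e hc x]
    have h2 := congrArg Prod.fst (hi (mul_right_cancel h1))
    simpa [hcA_def, hθ_apply] using h2.symm
  have hθAc : θ cA = cA := by rw [hθ_apply, hcA_def, hθc]
  -- the quotient `Q = (A₀/⟨u⟩) × C`, its involution, its size
  let π : A₀ →* A₀ ⧸ Subgroup.zpowers u := QuotientGroup.mk' (Subgroup.zpowers u)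
  haveI : Fintype (A₀ ⧸ Subgroup.zpowers u) := Fintype.ofFinite _
  have hπc1 : π c₀ ≠ 1 := fun h => hcu ((QuotientGroup.eq_one_iff c₀).1 h)
  have hπu : π u = 1 := (QuotientGroup.eq_one_iff u).2 (Subgroup.mem_zpowers u)
  have hcQ1 : ((π c₀, (1 : C)) : (A₀ ⧸ Subgroup.zpowers u) × C) ≠ 1 := by
    rw [Ne, Prod.mk_eq_one, not_and_or]; exact Or.inl hπc1
  have hcQ2 : ((π c₀, (1 : C)) : (A₀ ⧸ Subgroup.zpowers u) × C) * (π c₀, 1) = 1 := by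
    rw [Prod.mk_mul_mk, ← map_mul, hcc, map_one, mul_one]; rfl
  have hcardQ : 4 < Fintype.card ((A₀ ⧸ Subgroup.zpowers u) × C) := by
    have hL := Subgroup.card_eq_card_quotient_mul_card_subgroup (Subgroup.zpowers u)
    rw [Nat.card_eq_fintype_card, Nat.card_eq_fintype_card, Nat.card_eq_fintype_card, Fintype.card_zpowers] at hL
    rw [Fintype.card_prod]
    have hpos : 0 < orderOf u := orderOf_pos u
    by_contra hle
    push Not at hle
    have : Fintype.card A₀ * Fintype.card C ≤ 4 * orderOf u := by
      rw [hL]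
      calc Fintype.card (A₀ ⧸ Subgroup.zpowers u) * orderOf u * Fintype.card C
          = (Fintype.card (A₀ ⧸ Subgroup.zpowers u) * Fintype.card C) * orderOf u := by ring
        _ ≤ 4 * orderOf u := Nat.mul_le_mul_right _ hle
    omega
  -- the halves
  obtain ⟨S, hS, hSap⟩ := exists_aperiodic_half c₀ hc1 hcc hcard
  obtain ⟨H, hH, hHap⟩ := exists_aperiodic_half ((π c₀, (1 : C)) : (A₀ ⧸ Subgroup.zpowers u) × C) hcQ1 hcQ2 hcardQ
  -- the characters
  obtain ⟨χ₀, hχ₀c, hχ₀u⟩ := exists_odd_character_ne_one hc1 hcc hu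
  obtain ⟨ψ, hψ⟩ := exists_character_ne_one hγ₀
  let φ₁ : Additive (A₀ × C) →+ Additive A₀ :=
    { toFun := fun z => Additive.ofMul (Additive.toMul z).1, map_zero' := rfl, map_add' := fun _ _ => rfl }
  let φ₂ : Additive (A₀ × C) →+ Additive C :=
    { toFun := fun z => Additive.ofMul (Additive.toMul z).2, map_zero' := rfl, map_add' := fun _ _ => rfl }
  let χ : AddChar (Additive (A₀ × C)) ℂ := χ₀.compAddMonoidHom φ₁ * ψ.compAddMonoidHom φ₂
  have hχ_apply : ∀ (a : A₀) (γ : C), χ (Additive.ofMul (a, γ)) = χ₀ (Additive.ofMul a) * ψ (Additive.ofMul γ) :=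
    fun a γ => by rw [AddChar.mul_apply]; rfl
  have hχ : χ (Additive.ofMul cA) = -1 := by
    rw [hcA_def, hχ_apply, hχ₀c, ofMul_one, AddChar.map_zero_eq_one, mul_one]
  have hχ₀' : χ (Additive.ofMul (((1 : A₀), γ₀) : A₀ × C)) ≠ 1 := by
    rw [hχ_apply, ofMul_one, AddChar.map_zero_eq_one, one_mul]; exact hψ
  have hχ₁' : χ (Additive.ofMul ((u, (1 : C)) : A₀ × C)) ≠ 1 := by
    rw [hχ_apply, ofMul_one, AddChar.map_zero_eq_one, mul_one]; exact hχ₀u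
  -- the sheets
  set S₀ : Finset (A₀ × C) := Finset.univ.filter fun w => w.1 ∈ S with hS₀_def
  set S₁ : Finset (A₀ × C) := Finset.univ.filter fun w => (π w.1, w.2) ∈ H with hS₁_def
  have hS₀m : ∀ (a : A₀) (γ : C), (a, γ) ∈ S₀ ↔ a ∈ S := fun a γ => by simp [hS₀_def]
  have hS₁m : ∀ (a : A₀) (γ : C), (a, γ) ∈ S₁ ↔ (π a, γ) ∈ H := fun a γ => by simp [hS₁_def]
  have hS₀ : ∀ w, w ∈ S₀ ↔ cA * w ∉ S₀ := fun ⟨a, γ⟩ => by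
    rw [hcA_def, Prod.mk_mul_mk, hS₀m, hS₀m]; exact hS a
  have hS₁ : ∀ w, w ∈ S₁ ↔ cA * w ∉ S₁ := fun ⟨a, γ⟩ => by
    rw [hcA_def, Prod.mk_mul_mk, one_mul, hS₁m, hS₁m, map_mul]
    have h := hH (π a, γ)
    rwa [Prod.mk_mul_mk, one_mul] at h
  have hu₀ : ∀ w, w ∈ S₀ ↔ (((1 : A₀), γ₀) : A₀ × C) * w ∈ S₀ := fun ⟨a, γ⟩ => by
    rw [Prod.mk_mul_mk, one_mul, hS₀m, hS₀m]
  have hu₁ : ∀ w, w ∈ S₁ ↔ ((u, (1 : C)) : A₀ × C) * w ∈ S₁ := fun ⟨a, γ⟩ => by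
    rw [Prod.mk_mul_mk, one_mul, hS₁m, hS₁m, map_mul, hπu, one_mul]
  -- joint primitivity: no common period
  have hper : ∀ w : A₀ × C, w ≠ 1 → (∃ s, ¬ (s ∈ S₀ ↔ w * s ∈ S₀)) ∨ (∃ s, ¬ (s ∈ S₁ ↔ w * s ∈ S₁)) := by
    rintro ⟨α, γ⟩ hne
    by_cases hα : α = 1
    · subst hα
      have hγ : γ ≠ 1 := fun h => hne (by rw [h]; rfl)
      right
      have hq1 : ((π 1, γ) : (A₀ ⧸ Subgroup.zpowers u) × C) ≠ 1 := by
        rw [Ne, Prod.mk_eq_one, not_and_or]; exact Or.inr hγ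
      obtain ⟨⟨m, δ⟩, hm⟩ := hHap (π 1, γ) hq1
      obtain ⟨a, ha⟩ := QuotientGroup.mk'_surjective (Subgroup.zpowers u) m
      refine ⟨(a, δ), ?_⟩
      rw [Prod.mk_mul_mk, one_mul, hS₁m, hS₁m]
      rw [Prod.mk_mul_mk, map_one, one_mul] at hm
      change π a = m at ha
      rw [ha]; exact hm
    · left
      obtain ⟨s, hs⟩ := hSap α hα
      refine ⟨(s, 1), ?_⟩
      rwa [Prod.mk_mul_mk, mul_one, hS₀m, hS₀m]
  -- joint primitivity: `a·θ(S₀) ≠ S₁`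
  have hrefl : ∀ w : A₀ × C, (∃ s, ¬ (s ∈ S₀ ↔ w * θ s ∈ S₁)) ∨ (∃ s, ¬ (s ∈ S₁ ↔ w * θ s * q ∈ S₀)) := by
    rintro ⟨α, γ⟩
    left
    by_contra hcon
    push Not at hcon
    -- `H` would be `(1, γ₀)`-periodic
    have hq1 : ((π 1, γ₀) : (A₀ ⧸ Subgroup.zpowers u) × C) ≠ 1 := by
      rw [Ne, Prod.mk_eq_one, not_and_or]; exact Or.inr hγ₀
    obtain ⟨⟨m, δ⟩, hm⟩ := hHap (π 1, γ₀) hq1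
    obtain ⟨a', ha'⟩ := QuotientGroup.mk'_surjective (Subgroup.zpowers u) m
    change π a' = m at ha'
    -- choose `a` with `α θ₀ a = a'`
    set a : A₀ := θ₀.symm (α⁻¹ * a') with ha_def
    have hαa : α * θ₀ a = a' := by rw [ha_def, MulEquiv.apply_symm_apply, mul_inv_cancel_left]
    have e1 := hcon (a, γ⁻¹ * δ)
    have e2 := hcon (a, γ⁻¹ * (γ₀ * δ))
    rw [hθ_apply, Prod.mk_mul_mk, hαa, mul_inv_cancel_left, hS₀m, hS₁m, ha'] at e1 e2
    rw [Prod.mk_mul_mk, map_one, one_mul] at hm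
    exact hm (e1.symm.trans e2)
  exact exists_simple_degenerate_of_periodic_sheets e i hi x hx hcov θ hθ' q hq hc S₀ S₁ hS₀ hS₁ (1, γ₀) (u, 1) hu₀ hu₁ χ hχ
    hχ₀' hχ₁' hper hrefl

end Field

end Summit.HodgeConjecture.CorCM.SplitInvolution

end
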